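import Mathlib
import HarnessLib
import Summits.Ventures.LatticeQCDFlow.Scaling.U1WilsonIdentityFlowLaw
import Summits.Ventures.LatticeQCDFlow.Scaling.U1IdentityFlowStrict
import Summits.Ventures.LatticeQCDFlow.Scoring.U1TorusPlaquetteBounds

/-!
# LatticeQCDFlow / Scaling — the periodic-torus constraint changes the UNTRAINED U(1) sampler's
# figures of merit by at most a VOLUME-INDEPENDENT factor: sector-sum sandwich
# `I₀(γ)^V ≤ Σₖ I_{|k|}(γ)^V ≤ I₀(γ)^{V−1} e^γ`, hence
# `ESS_torus ∈ (I₀(β)²/I₀(2β))^V · [I₀(2β)e^{−2β}, e^{2β}/I₀(β)²]` and geometric collapse of `acc_torus`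

HONEST FRAMING: exact (Metropolis-corrected) sampling algorithms for lattice gauge theory;
figures of merit are autocorrelation/cost numbers at stated couplings and volumes; no
continuum-physics claim.

Venture `LatticeQCDFlow` (cell pub-lqcd), topic `Scaling`; FANOUT row 3 (`s0-u1-a`, S0-B
implementation A: the 2-d U(1) flow sampler, GEN-13).  NEW WORK of the cell (closed-form
inequalities, no numerics).  Row 3's `Scaling/U1WilsonIdentityFlowLaw` (GEN-13, imported) gives the
identity-flow ESS and acceptance sandwich of the 2-d U(1) Wilson sampler on the periodic
`L₁ × L₂` torus in terms of the sector sums `S_V(γ) = Σ_{k∈ℤ} I_{|k|}(γ)^V` (`V = L₁L₂`), while row 3's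
`Scaling/U1IdentityFlowVolumeLaw` (GEN-12) has the factorised (open-b.c.) model with `I₀(γ)^V` in
their place.  Row 5's Bessel bounds (`Scoring/U1TorusPlaquetteBounds`, imported: `0 < I_n ≤ I₀`,
`Σ_k I_{|k|} = e^γ`, summability of `I_{|k|}^V`) compare the two EXACTLY up to constants that do not
depend on the volume (`β > 0` throughout):

* §1 **`besselI_zero_pow_le_torusSum`** / **`torusSum_le`** —
  `I₀(γ)^V ≤ S_V(γ) ≤ I₀(γ)^{V−1}·e^γ` (`k = 0` term below; `I_{|k|}^V ≤ I₀^{V−1} I_{|k|}` and the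
  generating function at `θ = 0` above); `log_torusSum_mem_Icc` —
  `V log I₀(γ) ≤ log S_V(γ) ≤ (V−1) log I₀(γ) + γ` (by row 3's `U1WilsonIdentityFlowKL` this is the
  torus reverse KL against the factorised value `V log I₀(β)`: the constraint adds at most
  `β − log I₀(β)`, uniformly in `V`);
* §2 **`u1TorusIdentityFlow_essFrac_geometric`** —
  `(I₀(β)²/I₀(2β))^V · I₀(2β)e^{−2β} ≤ ESS_torus ≤ (I₀(β)²/I₀(2β))^V · e^{2β}/I₀(β)²`: the torus ESS
  is the factorised ESS `(I₀(β)²/I₀(2β))^V` up to a factor in `[I₀(2β)e^{−2β}, e^{2β}/I₀(β)²]`;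
* §3 **`u1TorusIdentityFlow_meanAccept_geometric`** —
  `(8/9)·(I₀(β)²/I₀(2β))^V·I₀(2β)e^{−2β} ≤ acc_torus ≤ (I₀(β/2)²/I₀(β))^V · e^β/I₀(β/2)²`: the
  equilibrium acceptance of the untrained exact sampler on the torus collapses geometrically in the
  number of plaquettes at the SAME two rates as the factorised model (both bases `< 1` for `β ≠ 0`,
  row 3's `sq_besselI_zero_lt` / `sq_besselI_zero_half_lt`), with volume-independent prefactors.

Reading (value-free; no number of ours is computed or implied): the single global (topological)
constraint distinguishing the periodic torus from the open lattice neither rescues nor worsens the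
exponential-in-volume collapse of the untrained sampler; it shifts ESS, acceptance and reverse KL by
bounded, explicit, `V`-independent factors.  NOT CLAIMED: sharp constants (the true ratios tend to `1`);
any value at the cell's `(β, L)`; nothing re-scored, SEALED.md untouched.
-/

noncomputable section

namespace Summit.Ventures.LatticeQCDFlow.Theory2

open MeasureTheory Real Set Finset
open Literature.Analysis.FunctionSpaces (besselI hasSum_besselI_natAbs summable_besselI_natAbs)
open Summit.Ventures.LatticeQCDFlow.Scoring

/-! ## §1 The sector-sum sandwich `I₀(γ)^V ≤ Σₖ I_{|k|}(γ)^V ≤ I₀(γ)^{V−1} e^γ` -/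

section SectorSum

variable {γ : ℝ} {V : ℕ}

/-- The sector sum is positive. [folklore] -/
theorem torusSum_pos (hγ : 0 < γ) (hV : 1 ≤ V) : 0 < ∑' k : ℤ, besselI k.natAbs γ ^ V :=
  (summable_besselI_natAbs_pow hγ hV).tsum_pos (fun _ => pow_nonneg (besselI_pos _ hγ).le _) 0
    (pow_pos (besselI_pos _ hγ) _)

/-- **Lower sector-sum bound**: `I₀(γ)^V ≤ Σₖ I_{|k|}(γ)^V` (the `k = 0` term). [ours] -/
theorem besselI_zero_pow_le_torusSum (hγ : 0 < γ) (hV : 1 ≤ V) :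
    besselI 0 γ ^ V ≤ ∑' k : ℤ, besselI k.natAbs γ ^ V := by
  have h := (summable_besselI_natAbs_pow hγ hV).le_tsum 0
    (fun _ _ => pow_nonneg (besselI_pos _ hγ).le _)
  simpa using h

/-- **Upper sector-sum bound**: `Σₖ I_{|k|}(γ)^V ≤ I₀(γ)^{V−1}·e^γ` (`I_{|k|} ≤ I₀` on `V − 1` factors,
then the generating function `Σₖ I_{|k|}(γ) = e^γ`). [ours] -/
theorem torusSum_le (hγ : 0 < γ) (hV : 1 ≤ V) :
    ∑' k : ℤ, besselI k.natAbs γ ^ V ≤ besselI 0 γ ^ (V - 1) * Real.exp γ := by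
  obtain ⟨W, rfl⟩ := Nat.exists_eq_add_of_le' hV
  rw [show W + 1 - 1 = W from rfl]
  have hle : ∀ k : ℤ, besselI k.natAbs γ ^ (W + 1) ≤ besselI 0 γ ^ W * besselI k.natAbs γ :=
    fun k => by
      rw [pow_succ]
      exact mul_le_mul_of_nonneg_right (pow_le_pow_left₀ (besselI_pos _ hγ).le
        (besselI_le_besselI_zero _ γ) W) (besselI_pos _ hγ).le
  calc ∑' k : ℤ, besselI k.natAbs γ ^ (W + 1)
      ≤ ∑' k : ℤ, besselI 0 γ ^ W * besselI k.natAbs γ :=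
        (summable_besselI_natAbs_pow hγ hV).tsum_le_tsum hle
          ((summable_besselI_natAbs γ).mul_left _)
    _ = besselI 0 γ ^ W * Real.exp γ := by rw [tsum_mul_left, (hasSum_besselI_natAbs γ).tsum_eq]

/-- **`V log I₀(γ) ≤ log Σₖ I_{|k|}(γ)^V ≤ (V − 1) log I₀(γ) + γ`.** [ours] -/
theorem log_torusSum_mem_Icc (hγ : 0 < γ) (hV : 1 ≤ V) :
    Real.log (∑' k : ℤ, besselI k.natAbs γ ^ V)
      ∈ Set.Icc ((V : ℝ) * Real.log (besselI 0 γ)) (((V : ℝ) - 1) * Real.log (besselI 0 γ) + γ) := by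
  have hI := besselI_pos 0 hγ
  have hS := torusSum_pos hγ hV
  constructor
  · rw [← Real.log_pow]
    exact Real.log_le_log (pow_pos hI _) (besselI_zero_pow_le_torusSum hγ hV)
  · have h := Real.log_le_log hS (torusSum_le hγ hV)
    rw [Real.log_mul (pow_pos hI _).ne' (Real.exp_pos _).ne', Real.log_exp, Real.log_pow,
      Nat.cast_sub hV, Nat.cast_one] at h
    exact h

/-- The two-sided comparison used below: for positive `A ≤ S₁ ≤ B` and `C ≤ S₂ ≤ D`,
`A²/D ≤ S₁²/S₂ ≤ B²/C`. [folklore] -/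
theorem sq_div_mem_Icc {A B C D S₁ S₂ : ℝ} (hA : 0 ≤ A) (hC : 0 < C) (h1 : A ≤ S₁) (h2 : S₁ ≤ B)
    (h3 : C ≤ S₂) (h4 : S₂ ≤ D) : S₁ ^ 2 / S₂ ∈ Set.Icc (A ^ 2 / D) (B ^ 2 / C) := by
  have hS₁ : 0 ≤ S₁ := hA.trans h1
  have hS₂ : 0 < S₂ := hC.trans_le h3
  exact ⟨div_le_div₀ (sq_nonneg _) (pow_le_pow_left₀ hA h1 2) hS₂ h4,
    div_le_div₀ (sq_nonneg _) (pow_le_pow_left₀ hS₁ h2 2) hC h3⟩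

end SectorSum

/-! ## §2 ESS on the torus vs the factorised model -/

section Torus

variable {L₁ L₂ : ℕ} [NeZero L₁] [NeZero L₂] {n : ℕ}
  (e : Fin 2 × (Fin L₁ × Fin L₂) ≃ Fin (n + 1)) {β : ℝ}

omit [NeZero L₁] [NeZero L₂] in
/-- `V = L₁L₂ ≥ 1`. [folklore] -/
theorem one_le_torusVolume [NeZero L₁] [NeZero L₂] : 1 ≤ L₁ * L₂ :=
  Nat.one_le_iff_ne_zero.2 (mul_ne_zero (NeZero.ne L₁) (NeZero.ne L₂))

/-- Algebra of the geometric bounds: `(I^{W+1})² / (J^W · E) = (I²/J)^{W+1} · (J / E)`. [folklore] -/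
theorem geometric_lower_eq {I J E : ℝ} (hJ : J ≠ 0) (hE : E ≠ 0) (W : ℕ) :
    (I ^ (W + 1)) ^ 2 / (J ^ W * E) = (I ^ 2 / J) ^ (W + 1) * (J / E) := by
  have h : (I ^ (W + 1)) ^ 2 = (I ^ 2) ^ (W + 1) := by rw [← pow_mul, ← pow_mul, mul_comm]
  rw [h, div_pow, pow_succ J W]
  field_simp

/-- Algebra of the geometric bounds: `(I^W · E)² / J^{W+1} = (I²/J)^{W+1} · (E² / I²)`. [folklore] -/
theorem geometric_upper_eq {I J E : ℝ} (hI : I ≠ 0) (hJ : J ≠ 0) (W : ℕ) :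
    (I ^ W * E) ^ 2 / J ^ (W + 1) = (I ^ 2 / J) ^ (W + 1) * (E ^ 2 / I ^ 2) := by
  have h : (I ^ W) ^ 2 = (I ^ 2) ^ W := by rw [← pow_mul, ← pow_mul, mul_comm]
  rw [mul_pow, h, div_pow, pow_succ (I ^ 2) W]
  field_simp

/-- **TORUS ESS vs FACTORISED ESS**: for `β > 0`,
`(I₀(β)²/I₀(2β))^V · I₀(2β)e^{−2β} ≤ ESS_torus ≤ (I₀(β)²/I₀(2β))^V · e^{2β}/I₀(β)²` (`V = L₁L₂`) —
the periodic-torus constraint changes the untrained sampler's effective sample size by a factor in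
`[I₀(2β)e^{−2β}, e^{2β}/I₀(β)²]`, uniformly in the volume. [ours] -/
theorem u1TorusIdentityFlow_essFrac_geometric (hβ : 0 < β) :
    (∫ θ in u1TorusBox (n + 1),
        u1WilsonWeight univ (torusInc e) (fun _ => β) θ / u1WilsonZ univ (torusInc e) (fun _ => β)) ^ 2
        / ∫ θ in u1TorusBox (n + 1),
          (u1WilsonWeight univ (torusInc e) (fun _ => β) θ
              / u1WilsonZ univ (torusInc e) (fun _ => β)) ^ 2 / (1 / (2 * π) ^ (n + 1))
      ∈ Set.Icc ((besselI 0 β ^ 2 / besselI 0 (2 * β)) ^ (L₁ * L₂)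
            * (besselI 0 (2 * β) / Real.exp (2 * β)))
          ((besselI 0 β ^ 2 / besselI 0 (2 * β)) ^ (L₁ * L₂)
            * (Real.exp β ^ 2 / besselI 0 β ^ 2)) := by
  have hV : 1 ≤ L₁ * L₂ := one_le_torusVolume
  have h2β : 0 < 2 * β := by linarith
  have hI := besselI_pos 0 hβ
  have hI2 := besselI_pos 0 h2β
  rw [u1TorusIdentityFlow_essFrac]
  have h := sq_div_mem_Icc (pow_pos hI _).le (pow_pos hI2 _)
    (besselI_zero_pow_le_torusSum hβ hV) (torusSum_le hβ hV)
    (besselI_zero_pow_le_torusSum h2β hV) (torusSum_le h2β hV)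
  obtain ⟨W, hW⟩ := Nat.exists_eq_add_of_le' hV
  rw [hW, show W + 1 - 1 = W from rfl, geometric_lower_eq hI2.ne' (Real.exp_pos _).ne',
    geometric_upper_eq hI.ne' hI2.ne'] at h
  rw [hW]
  exact h

/-! ## §3 The acceptance on the torus collapses geometrically in the volume -/

/-- **GEOMETRIC COLLAPSE OF THE UNTRAINED TORUS SAMPLER'S ACCEPTANCE**: for `β > 0`,
`(8/9)·(I₀(β)²/I₀(2β))^V · I₀(2β)e^{−2β} ≤ acc_torus ≤ (I₀(β/2)²/I₀(β))^V · e^β/I₀(β/2)²`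
(`V = L₁L₂`; both bases are `< 1` for `β ≠ 0` by row 3's `sq_besselI_zero_lt` /
`sq_besselI_zero_half_lt` of `Scaling/U1IdentityFlowStrict`, imported). [ours] -/
theorem u1TorusIdentityFlow_meanAccept_geometric (hβ : 0 < β) :
    ∫ θ in u1TorusBox (n + 1), ∫ θ' in u1TorusBox (n + 1),
        min (u1WilsonWeight univ (torusInc e) (fun _ => β) θ
              / u1WilsonZ univ (torusInc e) (fun _ => β) * (1 / (2 * π) ^ (n + 1)))
          (u1WilsonWeight univ (torusInc e) (fun _ => β) θ'
              / u1WilsonZ univ (torusInc e) (fun _ => β) * (1 / (2 * π) ^ (n + 1)))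
      ∈ Set.Icc (8 / 9 * ((besselI 0 β ^ 2 / besselI 0 (2 * β)) ^ (L₁ * L₂)
            * (besselI 0 (2 * β) / Real.exp (2 * β))))
          ((besselI 0 (β / 2) ^ 2 / besselI 0 β) ^ (L₁ * L₂)
            * (Real.exp (β / 2) ^ 2 / besselI 0 (β / 2) ^ 2)) := by
  have hV : 1 ≤ L₁ * L₂ := one_le_torusVolume
  have h2β : 0 < 2 * β := by linarith
  have hβ2 : 0 < β / 2 := by linarith
  have hI := besselI_pos 0 hβ
  have hI2 := besselI_pos 0 h2β
  have hIh := besselI_pos 0 hβ2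
  obtain ⟨hlo, hhi⟩ := u1TorusIdentityFlow_meanAccept_mem_Icc e β
  obtain ⟨W, hW⟩ := Nat.exists_eq_add_of_le' hV
  -- lower: through the ESS floor
  have hE := (sq_div_mem_Icc (pow_pos hI _).le (pow_pos hI2 _)
    (besselI_zero_pow_le_torusSum hβ hV) (torusSum_le hβ hV)
    (besselI_zero_pow_le_torusSum h2β hV) (torusSum_le h2β hV)).1
  -- upper: through the Bhattacharyya ceiling at `β/2`
  have hB := (sq_div_mem_Icc (pow_pos hIh _).le (pow_pos hI _)
    (besselI_zero_pow_le_torusSum hβ2 hV) (torusSum_le hβ2 hV)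
    (besselI_zero_pow_le_torusSum hβ hV) (torusSum_le hβ hV)).2
  rw [hW, show W + 1 - 1 = W from rfl] at hE hB
  rw [geometric_lower_eq hI2.ne' (Real.exp_pos _).ne'] at hE
  rw [geometric_upper_eq hIh.ne' hI.ne'] at hB
  rw [hW] at hlo hhi ⊢
  constructor
  · exact le_trans (mul_le_mul_of_nonneg_left hE (by norm_num)) hlo
  · exact hhi.trans hB

/-- **Exponential form of the upper rate**: with `ρ = I₀(β/2)²/I₀(β) < 1` (`β ≠ 0`), the torus
acceptance is at most `ρ^V · e^β/I₀(β/2)²` and `ρ^V → 0`. [ours] -/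
theorem tendsto_upperRate_pow_zero (hβ : β ≠ 0) :
    Filter.Tendsto (fun V : ℕ => (besselI 0 (β / 2) ^ 2 / besselI 0 β) ^ V) Filter.atTop
      (nhds 0) := by
  have hI : 0 < besselI 0 β := Literature.Analysis.FunctionSpaces.besselI_zero_pos β
  have hρ0 : 0 ≤ besselI 0 (β / 2) ^ 2 / besselI 0 β := div_nonneg (sq_nonneg _) hI.le
  have hρ1 : besselI 0 (β / 2) ^ 2 / besselI 0 β < 1 := by
    rw [div_lt_one hI]
    exact sq_besselI_zero_half_lt hβ
  exact tendsto_pow_atTop_nhds_zero_of_lt_one hρ0 hρ1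

end Torus

end Summit.Ventures.LatticeQCDFlow.Theory2

end
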